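import Literature.Geometry.Kaehler.ComplexTorusIntersectionMixedDiscriminantEquality
import HarnessLib

/-!
# The Khovanskii–Teissier inequalities `s_i^g ≥ s_0^{g-i} s_g^i`, the Brunn–Minkowski inequality
# `((L₀ + L)^g)^{1/g} ≥ (L₀^g)^{1/g} + (L^g)^{1/g}`, and Teissier's problem (all equality cases ⇔ proportionality)
# for two positive invariant `(1,1)`-classes on a complex torus (Cutkosky 2013, §6: Cor. 6.3, Prop. 6.5, Thm. 6.13)

Layer `Literature/Geometry/Kaehler`, namespace `Literature.Geometry.Kaehler.ComplexTorus`; lane `lit-hodgefound`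
(Track 2 foundations library, Layer A), seat p16, generation 21 (row g21-#3). Sequel of
`ComplexTorusIntersectionMixedDiscriminantEquality` §3 (generation 18: for two `(1,1)`-forms `η₀, η` on
`X = E/Φ(ℤ^ι)` and `s_k = (L₀^k · L^{g-k}) = Re ∫_X c₁(L₀)^{∧k} ∧ c₁(L)^{∧(g-k)}`, `c₁ = -η`, the LOG-CONCAVITY
`s_{k-1} s_{k+1} ≤ s_k²` for semi-positive forms — Cutkosky's (6.3) — and its equality case `s_{k-1} s_{k+1} = s_k² ⇔
η = c η₀` at each single `k` for positive forms, by Aleksandrov's inequality for mixed discriminants). Here the rest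
of Cutkosky's §6 for two classes is derived from these exactly as printed (the logarithms `log s_k` form a concave
sequence): the inequalities (6.4) `s_i^g ≥ s_0^{g-i} s_g^i` and (6.5) (Brunn–Minkowski, by the binomial expansion
`((α+β)^d) = Σ C(d,i) s_i`), the equivalence of the four equality conditions of Prop. 6.5, and Thm. 6.13 (=
Boucksom–Favre–Jonsson Thm. D): they hold iff the two classes are proportional — for POSITIVE invariant real
`(1,1)`-classes (not necessarily integral) on a complex torus of dimension `g ≥ 2`. Theorems only; no definition,
no named fact (net debt 0).

## Sources (verbatim)

* S. D. Cutkosky, *Teissier's problem on inequalities of nef divisors* (J. Algebra Appl. 14 (2015); arXiv 1304.1218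
  (2013)) [Cutkosky2013] (held `paper:arxiv-1304.1218`, pp. 18–20), §6, `X` complete of dimension `d`, `α, β` nef,
  `s_i = (α^i · β^{d-i})`: **Corollary 6.3 (Khovanskii Teissier inequalities)** "(6.3) `s_i² ≥ s_{i-1} s_{i+1}` for
  `1 ≤ i ≤ d-1`, (6.4) `s_i^d ≥ s_0^{d-i} s_d^i` for `0 ≤ i ≤ d`, and (6.5) `((α+β)^d)^{1/d} ≥ (α^d)^{1/d} + (β^d)^{1/d}`",
  with the proof of (6.5): "expand `((α+β)^d) = Σ_{i=0}^d C(d,i) s_i ≥ Σ_{i=0}^d C(d,i) (α^d)^{i/d} (β^d)^{(d-i)/d} =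
  ((α^d)^{1/d} + (β^d)^{1/d})^d`"; "The corollary tells us that the sequence `log s_0, …, log s_d` is concave";
  **Proposition 6.5** "Suppose that `α, β ∈ N¹(X)` are nef with `(α^d) > 0`, `(β^d) > 0`. Then the following are
  equivalent. 1) `s_i² = s_{i-1} s_{i+1}` for `1 ≤ i ≤ d` [sic; `≤ d - 1`] 2) `s_i^d = s_0^{d-i} s_d^i` for `0 ≤ i ≤ d`
  3) `s_{d-1}^d = s_0 s_d^{d-1}` 4) `((α+β)^d)^{1/d} = (α^d)^{1/d} + (β^d)^{1/d}`", proof: "From (6.3), we obtain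
  `s_{d-1}/s_0 = (s_{d-1}/s_{d-2})(s_{d-2}/s_{d-3})⋯(s_1/s_0) ≥ (s_d/s_{d-1})^{d-1}`. We have equality of the left and
  right hand terms if and only if `s_{d-1}^d = s_0 s_d^{d-1}` and if and only if all of the inequalities of (6.3) are
  equalities."; **Theorem 6.13** (= [BFJ] Thm. D over `ℂ`): these conditions hold "ii) [iff] `α` and `β` are
  proportional in `N¹(X)`"; Remark 6.14: bigness is needed.
* R. Schneider, *Convex Bodies* (1993) [Schneider1993], §6.8 Thm. 6.8.1 (Aleksandrov's inequality for mixed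
  discriminants with equality) and H. Lange, *Abelian Varieties over the Complex Numbers* (2023)
  [Lange2023AbelianVarietiesComplex], §2.2.1 p. 89 (`(L₁ · … · L_g) := ∫_X c₁(L₁) ∧ ⋯ ∧ c₁(L_g)`) — behind the tree's
  `torusIntegral_mixedFamily_mul_le_sq` / `torusIntegral_mixedFamily_mul_eq_sq_iff`, used BY NAME.
* F. W. Warner, *Foundations of Differentiable Manifolds and Lie Groups* [WarnerGTM94], 2.6 — the binomial expansion
  of a wedge power (tree: `wedgePow_add_eq_sum_choose`).

## What is proved

`X = E/Φ(ℤ^ι)` of dimension `g` (`e : Fin (2g) ≃ ι`), `η₀, η` POSITIVE real `(1,1)`-forms (`h₀`, `h`, `h₀pos`,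
`hpos`), `s_k := Re ∫_X (-η₀)^{∧k} ∧ (-η)^{∧(g-k)} = (L₀^k · L^{g-k})` (written out in full through the tree's
`wedgeFamily g (mixedFamily (ofRealForm (-η₀)) (ofRealForm (-η)) g k)` — no notation is introduced; `s_g = (L₀^g)`,
`s_0 = (L^g)`).

0. (private) concave real sequences lie above their chords, with the equality analysis of Prop. 6.5's proof.
1. `torusIntegral_wedgeFamily_mixedFamily_re_pos`: `s_k > 0`; `torusIntegral_mixedFamily_mul_le_sq'` ((6.3) for `s`);
   `log_torusIntegral_mixedFamily_concave`: `log s` is concave ("The corollary tells us that the sequence `log s_0, …, log s_d` is concave").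
2. **`torusIntegral_mixedFamily_pow_ge`** — Cor. 6.3 (6.4): `s_0^{g-k} s_g^k ≤ s_k^g` (`k ≤ g`).
3. **`torusIntegral_wedgePow_add_eq_sum_choose`**: `((L₀ + L)^g) = Σ_m C(g,m) s_{g-m}` (`c₁(L₀ ⊗ L) = c₁(L₀) + c₁(L)`);
   **`rpow_add_rpow_le_rpow_torusIntegral_wedgePow_add`** — Cor. 6.3 (6.5), Brunn–Minkowski:
   `(L₀^g)^{1/g} + (L^g)^{1/g} ≤ ((L₀ + L)^g)^{1/g}` (and the `g`-th-power form).
4. **Prop. 6.5 / Thm. 6.13**: each of 1) `∀ k, s_{k-1} s_{k+1} = s_k²`, 2) `∀ k, s_k^g = s_0^{g-k} s_g^k`,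
   3) `s_{g-1}^g = s_0 s_g^{g-1}`, 4) equality in Brunn–Minkowski is equivalent to `∃ c, η = c • η₀` (`g ≥ 2`):
   `torusIntegral_mixedFamily_forall_mul_eq_sq_iff`, `torusIntegral_mixedFamily_forall_pow_eq_iff`,
   `torusIntegral_mixedFamily_pow_pred_eq_iff`, `rpow_add_rpow_eq_rpow_torusIntegral_wedgePow_add_iff`.
5. `IsRiemannForm.` readings for two polarisations of an abelian variety.

NOT claimed: nef (semi-positive) classes with `(α^d), (β^d) > 0` (Cutkosky's generality; on the torus the tree has
(6.3) for semi-positive forms, but (6.4)–(6.5) and the equality cases are proved here for POSITIVE forms only —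
Remark 6.14: without bigness Thm. 6.13 fails); complete varieties other than complex tori; Thms. 6.9–6.12 (Diskant,
Teissier's bounds, Bonnesen).
-/

noncomputable section

set_option maxSynthPendingDepth 3

open scoped ComplexOrder ComplexConjugate
open Module Complex Function Finset

namespace Literature.Geometry.Kaehler

namespace ComplexTorus

/-! ## §0 Concave real sequences (the arithmetic of Cutkosky's proof of Prop. 6.5) -/

section Concave

/-- Steps of a concave sequence are non-increasing: `t_j - t_{j-1} ≤ t_i - t_{i-1}` for `1 ≤ i ≤ j ≤ d`
(the chain `s_{d-1}/s_{d-2} ≤ ⋯ ≤ s_1/s_0` of Cutkosky's proof, in logarithms).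
[cite: Cutkosky2013, §6 proof of Proposition 6.5 (arXiv PDF p. 18)] -/
private theorem step_antitone {t : ℕ → ℝ} {d : ℕ}
    (hc : ∀ k, 1 ≤ k → k + 1 ≤ d → t (k - 1) + t (k + 1) ≤ 2 * t k) {i j : ℕ} (hi : 1 ≤ i) (hij : i ≤ j)
    (hj : j ≤ d) : t j - t (j - 1) ≤ t i - t (i - 1) := by
  induction j, hij using Nat.le_induction with
  | base => exact le_rfl
  | succ j hij ih =>
    have h := hc j (by omega) hj
    have e : j + 1 - 1 = j := by omega
    rw [e]
    have := ih (by omega)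
    linarith

/-- Telescoping `t_k - t_0 = Σ_{i<k} (t_{i+1} - t_i)`. [folklore] -/
private theorem sub_eq_sum_steps (t : ℕ → ℝ) (k : ℕ) : t k - t 0 = ∑ i ∈ range k, (t (i + 1) - t i) := by
  rw [Finset.sum_range_sub]

/-- **A concave sequence lies above its chords**: `(d - k) t_0 + k t_d ≤ d t_k` for `k ≤ d` (Cutkosky's
"`(s_i/s_{i-1})^{d-i} ⋯ (s_1/s_0)^{d-i} ≥ (s_d/s_{d-1})^i ⋯ (s_{i+1}/s_i)^i`", in logarithms).
[cite: Cutkosky2013, §6 proof of Proposition 6.5 (arXiv PDF p. 18)] -/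
private theorem chord_le {t : ℕ → ℝ} {d : ℕ}
    (hc : ∀ k, 1 ≤ k → k + 1 ≤ d → t (k - 1) + t (k + 1) ≤ 2 * t k) {k : ℕ} (hk : k ≤ d) :
    ((d : ℝ) - k) * t 0 + k * t d ≤ d * t k := by
  rcases Nat.eq_zero_or_pos k with rfl | hk0
  · simp
  rcases hk.eq_or_lt with rfl | hkd
  · simp
  -- `t k - t 0 ≥ k * u_k`
  have h1 : (k : ℝ) * (t k - t (k - 1)) ≤ t k - t 0 := by
    rw [sub_eq_sum_steps t k]
    have : ∑ i ∈ range k, (t k - t (k - 1)) ≤ ∑ i ∈ range k, (t (i + 1) - t i) :=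
      Finset.sum_le_sum fun i hi ↦ by
        have hi' := Finset.mem_range.1 hi
        have := step_antitone hc (i := i + 1) (j := k) (by omega) (by omega) hk
        simpa using this
    rwa [Finset.sum_const, Finset.card_range, nsmul_eq_mul] at this
  -- `t d - t k ≤ (d - k) * u_{k+1} ≤ (d - k) * u_k`
  have h2 : t d - t k ≤ ((d : ℝ) - k) * (t k - t (k - 1)) := by
    have hsum : t d - t k = ∑ i ∈ range (d - k), (t (k + i + 1) - t (k + i)) := by
      have := Finset.sum_range_sub (fun i ↦ t (k + i)) (d - k)
      simp only [add_zero] at this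
      rw [show k + (d - k) = d by omega] at this
      rw [← this]
      refine Finset.sum_congr rfl fun i _ ↦ by rw [add_assoc]
    rw [hsum]
    have : ∑ i ∈ range (d - k), (t (k + i + 1) - t (k + i)) ≤ ∑ i ∈ range (d - k), (t k - t (k - 1)) :=
      Finset.sum_le_sum fun i hi ↦ by
        have hi' := Finset.mem_range.1 hi
        have := step_antitone hc (i := k) (j := k + i + 1) hk0 (by omega) (by omega)
        simpa [Nat.add_sub_cancel] using this
    rw [Finset.sum_const, Finset.card_range, nsmul_eq_mul, Nat.cast_sub hk] at this
    exact this
  have hdk : (0 : ℝ) ≤ (d : ℝ) - k := by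
    have : (k : ℝ) ≤ d := by exact_mod_cast hk
    linarith
  have hk0' : (0 : ℝ) ≤ k := by positivity
  nlinarith [mul_le_mul_of_nonneg_left h1 hdk, mul_le_mul_of_nonneg_left h2 hk0']

/-- **Equality at `k = d - 1` forces an arithmetic progression** ("We have equality of the left and right hand terms
if and only if `s_{d-1}^d = s_0 s_d^{d-1}` and if and only if all of the inequalities of (6.3) are equalities"): if
`d t_{d-1} = t_0 + (d-1) t_d` (`d ≥ 2`) then `t_{k-1} + t_{k+1} = 2 t_k` for every `1 ≤ k ≤ d-1`.
[cite: Cutkosky2013, §6 proof of Proposition 6.5 (arXiv PDF p. 18)] -/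
private theorem local_eq_of_chord_eq {t : ℕ → ℝ} {d : ℕ} (hd : 2 ≤ d)
    (hc : ∀ k, 1 ≤ k → k + 1 ≤ d → t (k - 1) + t (k + 1) ≤ 2 * t k)
    (heq : (d : ℝ) * t (d - 1) = t 0 + ((d : ℝ) - 1) * t d) :
    ∀ k, 1 ≤ k → k + 1 ≤ d → t (k - 1) + t (k + 1) = 2 * t k := by
  -- all steps `u_j = t_j - t_{j-1}`, `1 ≤ j ≤ d`, equal `u_d`
  have hsteps : ∀ j, 1 ≤ j → j ≤ d → t j - t (j - 1) = t d - t (d - 1) := by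
    have hsum : ∑ i ∈ range (d - 1), ((t (i + 1) - t i) - (t d - t (d - 1))) = 0 := by
      rw [Finset.sum_sub_distrib, ← sub_eq_sum_steps t (d - 1), Finset.sum_const, Finset.card_range, nsmul_eq_mul,
        Nat.cast_sub (by omega : 1 ≤ d), Nat.cast_one]
      linarith
    have hnn : ∀ i ∈ range (d - 1), 0 ≤ (t (i + 1) - t i) - (t d - t (d - 1)) := fun i hi ↦ by
      have hi' := Finset.mem_range.1 hi
      have := step_antitone hc (i := i + 1) (j := d) (by omega) (by omega) le_rfl
      simp only [Nat.add_sub_cancel] at this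
      linarith
    have hzero := (Finset.sum_eq_zero_iff_of_nonneg hnn).1 hsum
    intro j hj1 hjd
    rcases hjd.eq_or_lt with rfl | hjd'
    · rfl
    · have := hzero (j - 1) (Finset.mem_range.2 (by omega))
      rw [show j - 1 + 1 = j by omega] at this
      linarith
  intro k hk1 hkd
  have e1 := hsteps k hk1 (by omega)
  have e2 := hsteps (k + 1) (by omega) hkd
  rw [Nat.add_sub_cancel] at e2
  linarith

/-- **An arithmetic progression meets its chords**: local equalities give `d t_k = (d - k) t_0 + k t_d` ("the sequence
`log s_0, …, log s_d` is affine […] if and only if `log s_i = ½(log s_{i-1} + log s_{i+1})`").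
[cite: Cutkosky2013, §6 before Proposition 6.5 (arXiv PDF p. 18)] -/
private theorem chord_eq_of_local_eq {t : ℕ → ℝ} {d : ℕ}
    (hc : ∀ k, 1 ≤ k → k + 1 ≤ d → t (k - 1) + t (k + 1) = 2 * t k) {k : ℕ} (hk : k ≤ d) :
    ((d : ℝ) - k) * t 0 + k * t d = d * t k := by
  have h1 := chord_le (t := t) (d := d) (fun k h1 h2 ↦ (hc k h1 h2).le) hk
  have h2 := chord_le (t := fun i ↦ -t i) (d := d) (fun k h1 h2 ↦ by have := hc k h1 h2; linarith) hk
  linarith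

/-- **Multiplicative reading** for a positive log-concave sequence: `s_0^{d-k} s_d^k ≤ s_k^d`.
[cite: Cutkosky2013, §6 Corollary 6.3 (6.4) and its proof (arXiv PDF p. 18)] -/
private theorem pow_mul_pow_le_pow_of_logConcave {s : ℕ → ℝ} {d : ℕ} (hs : ∀ k, k ≤ d → 0 < s k)
    (hc : ∀ k, 1 ≤ k → k + 1 ≤ d → s (k - 1) * s (k + 1) ≤ s k ^ 2) {k : ℕ} (hk : k ≤ d) :
    s 0 ^ (d - k) * s d ^ k ≤ s k ^ d := by
  have hlog : ∀ k, 1 ≤ k → k + 1 ≤ d → Real.log (s (k - 1)) + Real.log (s (k + 1)) ≤ 2 * Real.log (s k) := by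
    intro k hk1 hkd
    rw [← Real.log_mul (hs _ (by omega)).ne' (hs _ hkd).ne', ← Real.log_rpow (hs k (by omega)), Real.rpow_two]
    exact Real.log_le_log (mul_pos (hs _ (by omega)) (hs _ hkd)) (hc k hk1 hkd)
  have h := chord_le (t := fun k ↦ Real.log (s k)) hlog hk
  rw [← Real.log_le_log_iff (mul_pos (pow_pos (hs 0 (Nat.zero_le _)) _) (pow_pos (hs d le_rfl) _))
    (pow_pos (hs k hk) _), Real.log_mul (pow_pos (hs 0 (Nat.zero_le _)) _).ne' (pow_pos (hs d le_rfl) _).ne',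
    Real.log_pow, Real.log_pow, Real.log_pow, Nat.cast_sub hk]
  exact h

/-- **Multiplicative equality analysis**: for a positive log-concave sequence with `d ≥ 2`,
`s_{d-1}^d = s_0 s_d^{d-1}` forces `s_{k-1} s_{k+1} = s_k²` for all `1 ≤ k ≤ d - 1`.
[cite: Cutkosky2013, §6 proof of Proposition 6.5, 3) ⇒ 1) (arXiv PDF p. 18)] -/
private theorem mul_eq_sq_of_pow_pred_eq {s : ℕ → ℝ} {d : ℕ} (hd : 2 ≤ d) (hs : ∀ k, k ≤ d → 0 < s k)
    (hc : ∀ k, 1 ≤ k → k + 1 ≤ d → s (k - 1) * s (k + 1) ≤ s k ^ 2)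
    (heq : s (d - 1) ^ d = s 0 * s d ^ (d - 1)) :
    ∀ k, 1 ≤ k → k + 1 ≤ d → s (k - 1) * s (k + 1) = s k ^ 2 := by
  have hlog : ∀ k, 1 ≤ k → k + 1 ≤ d → Real.log (s (k - 1)) + Real.log (s (k + 1)) ≤ 2 * Real.log (s k) := by
    intro k hk1 hkd
    rw [← Real.log_mul (hs _ (by omega)).ne' (hs _ hkd).ne', ← Real.log_rpow (hs k (by omega)), Real.rpow_two]
    exact Real.log_le_log (mul_pos (hs _ (by omega)) (hs _ hkd)) (hc k hk1 hkd)
  have heq' : (d : ℝ) * Real.log (s (d - 1)) = Real.log (s 0) + ((d : ℝ) - 1) * Real.log (s d) := by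
    have h := congrArg Real.log heq
    rw [Real.log_pow, Real.log_mul (hs 0 (Nat.zero_le _)).ne' (pow_pos (hs d le_rfl) _).ne', Real.log_pow,
      Nat.cast_sub (by omega : 1 ≤ d), Nat.cast_one] at h
    exact h
  intro k hk1 hkd
  have hl := local_eq_of_chord_eq (t := fun k ↦ Real.log (s k)) hd hlog heq' k hk1 hkd
  have e : Real.log (s (k - 1) * s (k + 1)) = Real.log (s k ^ 2) := by
    rw [Real.log_mul (hs _ (by omega)).ne' (hs _ hkd).ne', Real.log_pow, Nat.cast_two, hl]
  exact Real.log_injOn_pos (Set.mem_Ioi.2 (mul_pos (hs _ (by omega)) (hs _ hkd)))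
    (Set.mem_Ioi.2 (pow_pos (hs k (by omega)) _)) e

/-- **Local equalities give the global ones**: `s_{k-1} s_{k+1} = s_k²` for all `k` implies
`s_k^d = s_0^{d-k} s_d^k` for all `k ≤ d`. [cite: Cutkosky2013, §6 proof of Proposition 6.5, 1) ⇒ 2) (arXiv PDF p. 18)] -/
private theorem pow_eq_of_forall_mul_eq_sq {s : ℕ → ℝ} {d : ℕ} (hs : ∀ k, k ≤ d → 0 < s k)
    (hc : ∀ k, 1 ≤ k → k + 1 ≤ d → s (k - 1) * s (k + 1) = s k ^ 2) {k : ℕ} (hk : k ≤ d) :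
    s k ^ d = s 0 ^ (d - k) * s d ^ k := by
  have hlog : ∀ k, 1 ≤ k → k + 1 ≤ d → Real.log (s (k - 1)) + Real.log (s (k + 1)) = 2 * Real.log (s k) := by
    intro k hk1 hkd
    rw [← Real.log_mul (hs _ (by omega)).ne' (hs _ hkd).ne', ← Real.log_rpow (hs k (by omega)), Real.rpow_two,
      hc k hk1 hkd]
  have h := chord_eq_of_local_eq (t := fun k ↦ Real.log (s k)) hlog hk
  refine Real.log_injOn_pos (Set.mem_Ioi.2 (pow_pos (hs k hk) _))
    (Set.mem_Ioi.2 (mul_pos (pow_pos (hs 0 (Nat.zero_le _)) _) (pow_pos (hs d le_rfl) _))) ?_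
  rw [Real.log_mul (pow_pos (hs 0 (Nat.zero_le _)) _).ne' (pow_pos (hs d le_rfl) _).ne', Real.log_pow,
    Real.log_pow, Real.log_pow, Nat.cast_sub hk]
  linarith

end Concave

/-! ## §1 The mixed intersection numbers `s_k = (L₀^k · L^{g-k})` of two positive classes: positivity and
log-concavity -/

section Torus

variable {ι : Type*} [Fintype ι] [DecidableEq ι] {E : Type*} [NormedAddCommGroup E] [NormedSpace ℂ E]
  (Φ : (ι → ℝ) ≃L[ℝ] E) {g : ℕ}

/-! Throughout, `s : ℕ → ℝ` is ANY function agreeing with the mixed intersection numbers,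
`hs : ∀ k, s k = Re ∫_X (-η₀)^{∧k} ∧ (-η)^{∧(g-k)}` (instantiate with `s := fun k ↦ …`, `hs := fun _ ↦ rfl`); this keeps
the printed shape `s_k` of Cutkosky's statements. -/

omit [Fintype ι] [DecidableEq ι] in
/-- The normal-form family as a family of negated real forms. [cite: Lange2023AbelianVarietiesComplex, §2.2.1 p. 89] -/
private theorem mixedFamily_eq_ofRealForm (η₀ η : E [⋀^Fin 2]→L[ℝ] ℝ) (k : ℕ) :
    mixedFamily (ofRealForm (-η₀)) (ofRealForm (-η)) g k =
      fun j : Fin g ↦ ofRealForm (-(if (j : ℕ) < k then η₀ else η)) := by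
  funext j
  rw [mixedFamily_apply]
  split_ifs <;> rfl

omit [Fintype ι] [DecidableEq ι] in
/-- A positive `(1,1)`-form is semi-positive: `θ(iv, v) ≥ 0`. [cite: Lange2023AbelianVarietiesComplex, §2.2.1 p. 89] -/
private theorem twoForm_I_smul_self_nonneg {θ : E [⋀^Fin 2]→L[ℝ] ℝ} (hpos : ∀ v : E, v ≠ 0 → 0 < θ ![I • v, v])
    (v : E) : 0 ≤ θ ![I • v, v] := by
  by_cases hv : v = 0
  · subst hv; rw [smul_zero, twoForm_self]
  · exact (hpos v hv).le

section TwoForms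

variable {η₀ η : E [⋀^Fin 2]→L[ℝ] ℝ} {s : ℕ → ℝ}

/-- **`s_k = (L₀^k · L^{g-k}) > 0` for positive classes** (all slots positive: the tree's
`torusIntegral_wedgeFamily_re_pos_of_pos`; Cutkosky Lemma 6.4 "`(ℒ₁ · … · ℒ_d) > 0`" for nef and big classes).
[cite: Cutkosky2013, §6 Lemma 6.4 (arXiv PDF p. 18)] [cite: Lange2023AbelianVarietiesComplex, §2.2.1 p. 89] -/
theorem torusIntegral_wedgeFamily_mixedFamily_re_pos (e : Fin (2 * g) ≃ ι)
    (h₀ : ∀ x y : E, η₀ ![I • x, I • y] = η₀ ![x, y]) (h : ∀ x y : E, η ![I • x, I • y] = η ![x, y])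
    (h₀pos : ∀ v : E, v ≠ 0 → 0 < η₀ ![I • v, v]) (hpos : ∀ v : E, v ≠ 0 → 0 < η ![I • v, v])
    (hs : ∀ k, s k = (torusIntegral Φ e (wedgeFamily g (mixedFamily (ofRealForm (-η₀)) (ofRealForm (-η)) g k))).re)
    (k : ℕ) : 0 < s k := by
  rw [hs, mixedFamily_eq_ofRealForm]
  exact torusIntegral_wedgeFamily_re_pos_of_pos Φ e _
    (fun j x y ↦ by split_ifs; exacts [h₀ x y, h x y])
    (fun j v hv ↦ by split_ifs; exacts [h₀pos v hv, hpos v hv])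

/-- **Khovanskii–Teissier (6.3) on a complex torus, for `s`** (the tree's `torusIntegral_mixedFamily_mul_le_sq`):
`s_{k-1} s_{k+1} ≤ s_k²`. [cite: Cutkosky2013, §6 Corollary 6.3 (6.3) (arXiv PDF p. 18)] [cite: Schneider1993, §6.8 Theorem 6.8.1] -/
theorem torusIntegral_mixedFamily_mul_le_sq' (e : Fin (2 * g) ≃ ι)
    (h₀ : ∀ x y : E, η₀ ![I • x, I • y] = η₀ ![x, y]) (h : ∀ x y : E, η ![I • x, I • y] = η ![x, y])
    (h₀pos : ∀ v : E, v ≠ 0 → 0 < η₀ ![I • v, v]) (hpos : ∀ v : E, v ≠ 0 → 0 < η ![I • v, v])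
    (hs : ∀ k, s k = (torusIntegral Φ e (wedgeFamily g (mixedFamily (ofRealForm (-η₀)) (ofRealForm (-η)) g k))).re)
    {k : ℕ} (hk1 : 1 ≤ k) (hkg : k + 1 ≤ g) : s (k - 1) * s (k + 1) ≤ s k ^ 2 := by
  rw [hs, hs, hs]
  exact torusIntegral_mixedFamily_mul_le_sq Φ e η₀ η h₀ h (twoForm_I_smul_self_nonneg h₀pos)
    (twoForm_I_smul_self_nonneg hpos) hk1 hkg

/-- **`log s_k` is a concave sequence** ("The corollary tells us that the sequence `log s_0, log s_1, …, log s_d` is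
concave"). [cite: Cutkosky2013, §6 remark after the proof of Corollary 6.3 (arXiv PDF p. 18)] -/
theorem log_torusIntegral_mixedFamily_concave (e : Fin (2 * g) ≃ ι)
    (h₀ : ∀ x y : E, η₀ ![I • x, I • y] = η₀ ![x, y]) (h : ∀ x y : E, η ![I • x, I • y] = η ![x, y])
    (h₀pos : ∀ v : E, v ≠ 0 → 0 < η₀ ![I • v, v]) (hpos : ∀ v : E, v ≠ 0 → 0 < η ![I • v, v])
    (hs : ∀ k, s k = (torusIntegral Φ e (wedgeFamily g (mixedFamily (ofRealForm (-η₀)) (ofRealForm (-η)) g k))).re)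
    {k : ℕ} (hk1 : 1 ≤ k) (hkg : k + 1 ≤ g) :
    Real.log (s (k - 1)) + Real.log (s (k + 1)) ≤ 2 * Real.log (s k) := by
  have hp := torusIntegral_wedgeFamily_mixedFamily_re_pos Φ e h₀ h h₀pos hpos hs
  rw [← Real.log_mul (hp _).ne' (hp _).ne', ← Real.log_rpow (hp k), Real.rpow_two]
  exact Real.log_le_log (mul_pos (hp _) (hp _)) (torusIntegral_mixedFamily_mul_le_sq' Φ e h₀ h h₀pos hpos hs hk1 hkg)

/-! ## §2 Cor. 6.3 (6.4): `s_k^g ≥ s_0^{g-k} s_g^k` -/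

/-- **Khovanskii–Teissier inequality (6.4) on a complex torus**: for positive `(1,1)`-forms `η₀, η` and `k ≤ g`,
`(L^g)^{g-k} · (L₀^g)^k ≤ (L₀^k · L^{g-k})^g` (`s_0^{g-k} s_g^k ≤ s_k^g`).
[cite: Cutkosky2013, §6 Corollary 6.3 (6.4) (arXiv PDF p. 18)] [cite: Lange2023AbelianVarietiesComplex, §2.2.1 p. 89] -/
theorem torusIntegral_mixedFamily_pow_ge (e : Fin (2 * g) ≃ ι)
    (h₀ : ∀ x y : E, η₀ ![I • x, I • y] = η₀ ![x, y]) (h : ∀ x y : E, η ![I • x, I • y] = η ![x, y])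
    (h₀pos : ∀ v : E, v ≠ 0 → 0 < η₀ ![I • v, v]) (hpos : ∀ v : E, v ≠ 0 → 0 < η ![I • v, v])
    (hs : ∀ k, s k = (torusIntegral Φ e (wedgeFamily g (mixedFamily (ofRealForm (-η₀)) (ofRealForm (-η)) g k))).re)
    {k : ℕ} (hk : k ≤ g) : s 0 ^ (g - k) * s g ^ k ≤ s k ^ g :=
  pow_mul_pow_le_pow_of_logConcave (fun k _ ↦ torusIntegral_wedgeFamily_mixedFamily_re_pos Φ e h₀ h h₀pos hpos hs k)
    (fun _ hk1 hkg ↦ torusIntegral_mixedFamily_mul_le_sq' Φ e h₀ h h₀pos hpos hs hk1 hkg) hk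

/-! ## §3 Cor. 6.3 (6.5): the Brunn–Minkowski inequality `((L₀ ⊗ L)^g)^{1/g} ≥ (L₀^g)^{1/g} + (L^g)^{1/g}` -/

omit [Fintype ι] in
/-- **The binomial expansion of a top self-intersection**: `((L₀ ⊗ L)^g) = Σ_{m=0}^{g} C(g,m) (L₀^{g-m} · L^m)`
("expand `((α+β)^d) = Σ_{i=0}^d C(d,i) s_i`"; `c₁(L₀ ⊗ L) = c₁(L₀) + c₁(L)`, the tree's `wedgePow_add_eq_sum_choose`
integrated over `X`). [cite: Cutkosky2013, §6 proof of Corollary 6.3, (6.6) (arXiv PDF p. 18)]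
[cite: WarnerGTM94, 2.6] -/
theorem torusIntegral_wedgePow_add_eq_sum_choose (e : Fin (2 * g) ≃ ι) (η₀ η : E [⋀^Fin 2]→L[ℝ] ℝ) {s : ℕ → ℝ}
    (hs : ∀ k, s k = (torusIntegral Φ e (wedgeFamily g (mixedFamily (ofRealForm (-η₀)) (ofRealForm (-η)) g k))).re) :
    (torusIntegral Φ e (wedgePow (ofRealForm (-(η₀ + η))) g)).re =
      ∑ m ∈ range (g + 1), (g.choose m : ℝ) * s (g - m) := by
  rw [neg_add, ofRealForm_add, wedgePow_add_eq_sum_choose, torusIntegral_finset_sum, Complex.re_sum]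
  refine Finset.sum_congr rfl fun m _ ↦ ?_
  rw [hs, ← Nat.cast_smul_eq_nsmul ℂ, torusIntegral_smul, ← Complex.ofReal_natCast, Complex.re_ofReal_mul]

/-- **Brunn–Minkowski on a complex torus, `g`-th-power form**: for positive `(1,1)`-forms `η₀, η`,
`((L₀^g)^{1/g} + (L^g)^{1/g})^g ≤ ((L₀ ⊗ L)^g)` ("`Σ C(d,i) s_i ≥ Σ C(d,i) (α^d)^{i/d} (β^d)^{(d-i)/d}
= ((α^d)^{1/d} + (β^d)^{1/d})^d`"). [cite: Cutkosky2013, §6 Corollary 6.3 (6.5) and (6.6) (arXiv PDF p. 18)] -/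
theorem rpow_add_rpow_pow_le_torusIntegral_wedgePow_add (e : Fin (2 * g) ≃ ι)
    (h₀ : ∀ x y : E, η₀ ![I • x, I • y] = η₀ ![x, y]) (h : ∀ x y : E, η ![I • x, I • y] = η ![x, y])
    (h₀pos : ∀ v : E, v ≠ 0 → 0 < η₀ ![I • v, v]) (hpos : ∀ v : E, v ≠ 0 → 0 < η ![I • v, v])
    (hs : ∀ k, s k = (torusIntegral Φ e (wedgeFamily g (mixedFamily (ofRealForm (-η₀)) (ofRealForm (-η)) g k))).re)
    (hg : 1 ≤ g) :
    (s g ^ (1 / g : ℝ) + s 0 ^ (1 / g : ℝ)) ^ g ≤ (torusIntegral Φ e (wedgePow (ofRealForm (-(η₀ + η))) g)).re := by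
  have hp := torusIntegral_wedgeFamily_mixedFamily_re_pos Φ e h₀ h h₀pos hpos hs
  set A : ℝ := s g ^ (1 / g : ℝ) with hA
  set B : ℝ := s 0 ^ (1 / g : ℝ) with hB
  have hA0 : 0 ≤ A := Real.rpow_nonneg (hp g).le _
  have hB0 : 0 ≤ B := Real.rpow_nonneg (hp 0).le _
  have hAg : A ^ g = s g := by rw [hA, one_div, Real.rpow_inv_natCast_pow (hp g).le (by omega)]
  have hBg : B ^ g = s 0 := by rw [hB, one_div, Real.rpow_inv_natCast_pow (hp 0).le (by omega)]
  -- termwise: `A^{g-m} B^m ≤ s_{g-m}` from (6.4)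
  have hterm : ∀ m ∈ range (g + 1), A ^ (g - m) * B ^ m ≤ s (g - m) := by
    intro m hm
    have hm' : m ≤ g := Nat.lt_succ_iff.1 (Finset.mem_range.1 hm)
    have h64 := torusIntegral_mixedFamily_pow_ge Φ e h₀ h h₀pos hpos hs (k := g - m) (Nat.sub_le g m)
    rw [show g - (g - m) = m by omega, ← hAg, ← hBg, ← pow_mul, ← pow_mul, mul_comm g m, mul_comm g (g - m),
      pow_mul, pow_mul, ← mul_pow, mul_comm (B ^ m)] at h64
    exact le_of_pow_le_pow_left₀ (by omega) (hp _).le h64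
  rw [torusIntegral_wedgePow_add_eq_sum_choose Φ e η₀ η hs, add_comm A B, add_pow]
  refine Finset.sum_le_sum fun m hm ↦ ?_
  rw [mul_comm (B ^ m), ← mul_comm ((g.choose m : ℝ))]
  exact mul_le_mul_of_nonneg_left (hterm m hm) (Nat.cast_nonneg _)

/-- **The Brunn–Minkowski inequality on a complex torus** (Khovanskii–Teissier (6.5)): for positive `(1,1)`-forms
`η₀, η` on `X = E/Φ(ℤ^ι)` of dimension `g ≥ 1`, `(L₀^g)^{1/g} + (L^g)^{1/g} ≤ ((L₀ ⊗ L)^g)^{1/g}`. The tree has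
this for polarisations (`polarizationDegree_rpow_add_le`, by Minkowski's determinant inequality); here for
arbitrary positive real `(1,1)`-classes, by the printed road (6.4) + binomial expansion.
[cite: Cutkosky2013, §6 Corollary 6.3 (6.5) (arXiv PDF p. 18)] [cite: Lange2023AbelianVarietiesComplex, §2.2.1 p. 89] -/
theorem rpow_add_rpow_le_rpow_torusIntegral_wedgePow_add (e : Fin (2 * g) ≃ ι)
    (h₀ : ∀ x y : E, η₀ ![I • x, I • y] = η₀ ![x, y]) (h : ∀ x y : E, η ![I • x, I • y] = η ![x, y])
    (h₀pos : ∀ v : E, v ≠ 0 → 0 < η₀ ![I • v, v]) (hpos : ∀ v : E, v ≠ 0 → 0 < η ![I • v, v])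
    (hs : ∀ k, s k = (torusIntegral Φ e (wedgeFamily g (mixedFamily (ofRealForm (-η₀)) (ofRealForm (-η)) g k))).re)
    (hg : 1 ≤ g) :
    s g ^ (1 / g : ℝ) + s 0 ^ (1 / g : ℝ) ≤ (torusIntegral Φ e (wedgePow (ofRealForm (-(η₀ + η))) g)).re ^ (1 / g : ℝ) := by
  have hp := torusIntegral_wedgeFamily_mixedFamily_re_pos Φ e h₀ h h₀pos hpos hs
  have h1 := rpow_add_rpow_pow_le_torusIntegral_wedgePow_add Φ e h₀ h h₀pos hpos hs hg
  have hS0 : 0 ≤ s g ^ (1 / g : ℝ) + s 0 ^ (1 / g : ℝ) :=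
    add_nonneg (Real.rpow_nonneg (hp g).le _) (Real.rpow_nonneg (hp 0).le _)
  have h2 := Real.rpow_le_rpow (pow_nonneg hS0 g) h1 (by positivity : (0 : ℝ) ≤ 1 / g)
  rwa [← Real.rpow_natCast, ← Real.rpow_mul hS0, mul_one_div_cancel (by positivity : (g : ℝ) ≠ 0),
    Real.rpow_one] at h2

/-! ## §4 Prop. 6.5 and Thm. 6.13: all equality cases are equivalent to proportionality -/

/-- **Prop. 6.5 1) ⇔ Thm. 6.13 ii) on a complex torus**: for positive `(1,1)`-forms `η₀, η` (`g ≥ 2`),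
`s_{k-1} s_{k+1} = s_k²` for ALL `1 ≤ k ≤ g - 1` iff `η = c • η₀` — from the tree's single-`k` equality case
`torusIntegral_mixedFamily_mul_eq_sq_iff` at `k = 1`. [cite: Cutkosky2013, §6 Proposition 6.5 1) and Theorem 6.13 (arXiv PDF pp. 18, 20)]
[cite: Schneider1993, §6.8 Theorem 6.8.1] -/
theorem torusIntegral_mixedFamily_forall_mul_eq_sq_iff (e : Fin (2 * g) ≃ ι)
    (h₀ : ∀ x y : E, η₀ ![I • x, I • y] = η₀ ![x, y]) (h : ∀ x y : E, η ![I • x, I • y] = η ![x, y])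
    (h₀pos : ∀ v : E, v ≠ 0 → 0 < η₀ ![I • v, v]) (hpos : ∀ v : E, v ≠ 0 → 0 < η ![I • v, v])
    (hs : ∀ k, s k = (torusIntegral Φ e (wedgeFamily g (mixedFamily (ofRealForm (-η₀)) (ofRealForm (-η)) g k))).re)
    (hg : 2 ≤ g) :
    (∀ k, 1 ≤ k → k + 1 ≤ g → s (k - 1) * s (k + 1) = s k ^ 2) ↔ ∃ c : ℝ, η = c • η₀ := by
  constructor
  · intro hall
    have h1 := hall 1 le_rfl hg
    rw [hs, hs, hs] at h1
    exact (torusIntegral_mixedFamily_mul_eq_sq_iff Φ e η₀ η h₀ h h₀pos hpos le_rfl hg).1 h1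
  · intro hc k hk1 hkg
    rw [hs, hs, hs]
    exact (torusIntegral_mixedFamily_mul_eq_sq_iff Φ e η₀ η h₀ h h₀pos hpos hk1 hkg).2 hc

/-- **Prop. 6.5 3) ⇔ Thm. 6.13 ii)**: `s_{g-1}^g = s_0 s_g^{g-1}`, i.e. `(L₀^{g-1} · L)^g = (L^g)(L₀^g)^{g-1}`, iff
`η = c • η₀` (`g ≥ 2`, positive forms). The tree's `IsRiemannForm.hodgeTypeInequality_eq_iff` is this for two
polarisations by the eigenvalue road; here for positive real classes by Cutkosky's log-concavity road.
[cite: Cutkosky2013, §6 Proposition 6.5 3) and Theorem 6.13 (arXiv PDF pp. 18, 20)] -/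
theorem torusIntegral_mixedFamily_pow_pred_eq_iff (e : Fin (2 * g) ≃ ι)
    (h₀ : ∀ x y : E, η₀ ![I • x, I • y] = η₀ ![x, y]) (h : ∀ x y : E, η ![I • x, I • y] = η ![x, y])
    (h₀pos : ∀ v : E, v ≠ 0 → 0 < η₀ ![I • v, v]) (hpos : ∀ v : E, v ≠ 0 → 0 < η ![I • v, v])
    (hs : ∀ k, s k = (torusIntegral Φ e (wedgeFamily g (mixedFamily (ofRealForm (-η₀)) (ofRealForm (-η)) g k))).re)
    (hg : 2 ≤ g) :
    s (g - 1) ^ g = s 0 * s g ^ (g - 1) ↔ ∃ c : ℝ, η = c • η₀ := by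
  have hp := torusIntegral_wedgeFamily_mixedFamily_re_pos Φ e h₀ h h₀pos hpos hs
  have hc : ∀ k, 1 ≤ k → k + 1 ≤ g → s (k - 1) * s (k + 1) ≤ s k ^ 2 :=
    fun k hk1 hkg ↦ torusIntegral_mixedFamily_mul_le_sq' Φ e h₀ h h₀pos hpos hs hk1 hkg
  rw [← torusIntegral_mixedFamily_forall_mul_eq_sq_iff Φ e h₀ h h₀pos hpos hs hg]
  constructor
  · intro heq
    exact mul_eq_sq_of_pow_pred_eq hg (fun k _ ↦ hp k) hc heq
  · intro hall
    rw [pow_eq_of_forall_mul_eq_sq (d := g) (fun k _ ↦ hp k) hall (Nat.sub_le g 1),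
      show g - (g - 1) = 1 by omega, pow_one]

/-- **Prop. 6.5 2) ⇔ Thm. 6.13 ii)**: `s_k^g = s_0^{g-k} s_g^k` for ALL `k ≤ g` iff `η = c • η₀` (`g ≥ 2`, positive
forms). [cite: Cutkosky2013, §6 Proposition 6.5 2) and Theorem 6.13 (arXiv PDF pp. 18, 20)] -/
theorem torusIntegral_mixedFamily_forall_pow_eq_iff (e : Fin (2 * g) ≃ ι)
    (h₀ : ∀ x y : E, η₀ ![I • x, I • y] = η₀ ![x, y]) (h : ∀ x y : E, η ![I • x, I • y] = η ![x, y])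
    (h₀pos : ∀ v : E, v ≠ 0 → 0 < η₀ ![I • v, v]) (hpos : ∀ v : E, v ≠ 0 → 0 < η ![I • v, v])
    (hs : ∀ k, s k = (torusIntegral Φ e (wedgeFamily g (mixedFamily (ofRealForm (-η₀)) (ofRealForm (-η)) g k))).re)
    (hg : 2 ≤ g) :
    (∀ k, k ≤ g → s k ^ g = s 0 ^ (g - k) * s g ^ k) ↔ ∃ c : ℝ, η = c • η₀ := by
  have hp := torusIntegral_wedgeFamily_mixedFamily_re_pos Φ e h₀ h h₀pos hpos hs
  constructor
  · intro hall
    refine (torusIntegral_mixedFamily_pow_pred_eq_iff Φ e h₀ h h₀pos hpos hs hg).1 ?_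
    rw [hall (g - 1) (Nat.sub_le g 1), show g - (g - 1) = 1 by omega, pow_one]
  · intro hc k hk
    have hall := (torusIntegral_mixedFamily_forall_mul_eq_sq_iff Φ e h₀ h h₀pos hpos hs hg).2 hc
    exact pow_eq_of_forall_mul_eq_sq (d := g) (fun k _ ↦ hp k) hall hk

/-- **Prop. 6.5 4) ⇔ Thm. 6.13 ii): equality in Brunn–Minkowski** — `(L₀^g)^{1/g} + (L^g)^{1/g} = ((L₀ ⊗ L)^g)^{1/g}`
iff `η = c • η₀` (`g ≥ 2`, positive forms; the tree's `polarizationDegree_rpow_add_eq_iff` is the case of two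
polarisations). [cite: Cutkosky2013, §6 Proposition 6.5 4) and Theorem 6.13 (arXiv PDF pp. 18, 20)] -/
theorem rpow_add_rpow_eq_rpow_torusIntegral_wedgePow_add_iff (e : Fin (2 * g) ≃ ι)
    (h₀ : ∀ x y : E, η₀ ![I • x, I • y] = η₀ ![x, y]) (h : ∀ x y : E, η ![I • x, I • y] = η ![x, y])
    (h₀pos : ∀ v : E, v ≠ 0 → 0 < η₀ ![I • v, v]) (hpos : ∀ v : E, v ≠ 0 → 0 < η ![I • v, v])
    (hs : ∀ k, s k = (torusIntegral Φ e (wedgeFamily g (mixedFamily (ofRealForm (-η₀)) (ofRealForm (-η)) g k))).re)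
    (hg : 2 ≤ g) :
    s g ^ (1 / g : ℝ) + s 0 ^ (1 / g : ℝ) = (torusIntegral Φ e (wedgePow (ofRealForm (-(η₀ + η))) g)).re ^ (1 / g : ℝ) ↔
      ∃ c : ℝ, η = c • η₀ := by
  have hp := torusIntegral_wedgeFamily_mixedFamily_re_pos Φ e h₀ h h₀pos hpos hs
  set A : ℝ := s g ^ (1 / g : ℝ) with hA
  set B : ℝ := s 0 ^ (1 / g : ℝ) with hB
  have hA0 : 0 ≤ A := Real.rpow_nonneg (hp g).le _
  have hB0 : 0 ≤ B := Real.rpow_nonneg (hp 0).le _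
  have hAg : A ^ g = s g := by rw [hA, one_div, Real.rpow_inv_natCast_pow (hp g).le (by omega)]
  have hBg : B ^ g = s 0 := by rw [hB, one_div, Real.rpow_inv_natCast_pow (hp 0).le (by omega)]
  have hApos : 0 < A := by rw [hA]; exact Real.rpow_pos_of_pos (hp g) _
  have hBpos : 0 < B := by rw [hB]; exact Real.rpow_pos_of_pos (hp 0) _
  have hT0 : 0 < (torusIntegral Φ e (wedgePow (ofRealForm (-(η₀ + η))) g)).re :=
    lt_of_lt_of_le (pow_pos (add_pos hApos hBpos) g)
      (rpow_add_rpow_pow_le_torusIntegral_wedgePow_add Φ e h₀ h h₀pos hpos hs (by omega))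
  -- termwise inequalities `C(g,m) A^{g-m} B^m ≤ C(g,m) s_{g-m}` from (6.4)
  have hterm : ∀ m ∈ range (g + 1), A ^ (g - m) * B ^ m ≤ s (g - m) := by
    intro m hm
    have h64 := torusIntegral_mixedFamily_pow_ge Φ e h₀ h h₀pos hpos hs (k := g - m) (Nat.sub_le g m)
    rw [show g - (g - m) = m by have := Finset.mem_range.1 hm; omega, ← hAg, ← hBg, ← pow_mul, ← pow_mul,
      mul_comm g m, mul_comm g (g - m), pow_mul, pow_mul, ← mul_pow, mul_comm (B ^ m)] at h64
    exact le_of_pow_le_pow_left₀ (by omega) (hp _).le h64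
  -- the `g`-th-power form of the equality
  have key : A + B = (torusIntegral Φ e (wedgePow (ofRealForm (-(η₀ + η))) g)).re ^ (1 / g : ℝ) ↔
      (A + B) ^ g = (torusIntegral Φ e (wedgePow (ofRealForm (-(η₀ + η))) g)).re := by
    constructor
    · intro hE
      rw [hE, one_div, Real.rpow_inv_natCast_pow hT0.le (by omega)]
    · intro hE
      rw [← hE, one_div, Real.pow_rpow_inv_natCast (add_nonneg hA0 hB0) (by omega)]
  rw [key, torusIntegral_wedgePow_add_eq_sum_choose Φ e η₀ η hs, add_comm A B, add_pow,
    ← torusIntegral_mixedFamily_forall_pow_eq_iff Φ e h₀ h h₀pos hpos hs hg]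
  have hle : ∀ m ∈ range (g + 1), B ^ m * A ^ (g - m) * (g.choose m : ℝ) ≤ (g.choose m : ℝ) * s (g - m) :=
    fun m hm ↦ by
      rw [mul_comm (B ^ m), ← mul_comm ((g.choose m : ℝ))]
      exact mul_le_mul_of_nonneg_left (hterm m hm) (Nat.cast_nonneg _)
  rw [Finset.sum_eq_sum_iff_of_le hle]
  constructor
  · -- termwise equality ⇒ `s_k = A^k B^{g-k}` ⇒ `s_k^g = s_0^{g-k} s_g^k`
    intro hall k hk
    have hk' := hall (g - k) (Finset.mem_range.2 (by omega))
    rw [show g - (g - k) = k by omega, mul_comm (B ^ (g - k)), ← mul_comm ((g.choose (g - k) : ℝ))] at hk'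
    have hch : (g.choose (g - k) : ℝ) ≠ 0 := by exact_mod_cast (Nat.choose_pos (Nat.sub_le g k)).ne'
    have hsk : s k = A ^ k * B ^ (g - k) := (mul_left_cancel₀ hch hk').symm
    rw [hsk, mul_pow, ← pow_mul, ← pow_mul, mul_comm k g, mul_comm (g - k) g, pow_mul, pow_mul, hAg, hBg, mul_comm]
  · -- `s_k^g = s_0^{g-k} s_g^k` ⇒ `s_{g-m} = B^m A^{g-m}` ⇒ termwise equality
    intro hall m hm
    have hm' : m ≤ g := Nat.lt_succ_iff.1 (Finset.mem_range.1 hm)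
    have hk := hall (g - m) (Nat.sub_le g m)
    rw [show g - (g - m) = m by omega, ← hAg, ← hBg, ← pow_mul, ← pow_mul, mul_comm g m, mul_comm g (g - m),
      pow_mul, pow_mul, ← mul_pow] at hk
    have hsm : s (g - m) = B ^ m * A ^ (g - m) :=
      (pow_left_inj₀ (hp _).le (mul_nonneg (pow_nonneg hB0 _) (pow_nonneg hA0 _)) (by omega)).1 hk
    rw [hsm]
    ring

end TwoForms

/-! ## §5 Two polarisations of an abelian variety -/

section Polarised

variable {η₀ η : E [⋀^Fin 2]→L[ℝ] ℝ} {s : ℕ → ℝ}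

/-- **Khovanskii–Teissier (6.4) for two polarisations** `L₀, L` of an abelian variety (`η₀, η` Riemann forms):
`(L^g)^{g-k} (L₀^g)^k ≤ (L₀^k · L^{g-k})^g`. [cite: Cutkosky2013, §6 Corollary 6.3 (6.4) (arXiv PDF p. 18)]
[cite: Lange2023AbelianVarietiesComplex, §2.2.1 p. 89] -/
theorem IsRiemannForm.torusIntegral_mixedFamily_pow_ge (e : Fin (2 * g) ≃ ι) (hη₀ : IsRiemannForm Φ η₀)
    (hη : IsRiemannForm Φ η)
    (hs : ∀ k, s k = (torusIntegral Φ e (wedgeFamily g (mixedFamily (ofRealForm (-η₀)) (ofRealForm (-η)) g k))).re)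
    {k : ℕ} (hk : k ≤ g) : s 0 ^ (g - k) * s g ^ k ≤ s k ^ g :=
  ComplexTorus.torusIntegral_mixedFamily_pow_ge Φ e hη₀.1 hη.1 hη₀.2.2 hη.2.2 hs hk

/-- **Brunn–Minkowski for two polarisations** (a second proof of the tree's `polarizationDegree_rpow_add_le`, in
the intersection-number normalisation): `(L₀^g)^{1/g} + (L^g)^{1/g} ≤ ((L₀ ⊗ L)^g)^{1/g}`.
[cite: Cutkosky2013, §6 Corollary 6.3 (6.5) (arXiv PDF p. 18)] [cite: Lange2023AbelianVarietiesComplex, §2.2.1 p. 89] -/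
theorem IsRiemannForm.rpow_add_rpow_le_rpow_torusIntegral_wedgePow_add (e : Fin (2 * g) ≃ ι)
    (hη₀ : IsRiemannForm Φ η₀) (hη : IsRiemannForm Φ η)
    (hs : ∀ k, s k = (torusIntegral Φ e (wedgeFamily g (mixedFamily (ofRealForm (-η₀)) (ofRealForm (-η)) g k))).re)
    (hg : 1 ≤ g) :
    s g ^ (1 / g : ℝ) + s 0 ^ (1 / g : ℝ) ≤ (torusIntegral Φ e (wedgePow (ofRealForm (-(η₀ + η))) g)).re ^ (1 / g : ℝ) :=
  ComplexTorus.rpow_add_rpow_le_rpow_torusIntegral_wedgePow_add Φ e hη₀.1 hη.1 hη₀.2.2 hη.2.2 hs hg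

/-- **Teissier's problem for two polarisations** (Thm. 6.13 = BFJ Thm. D, on an abelian variety of dimension
`g ≥ 2`): `(L₀^{g-1} · L)^g = (L^g)(L₀^g)^{g-1}` iff `c₁(L) = c · c₁(L₀)`.
[cite: Cutkosky2013, §6 Theorem 6.13 (arXiv PDF p. 20)] [cite: Lange2023AbelianVarietiesComplex, §2.2.1 p. 89] -/
theorem IsRiemannForm.torusIntegral_mixedFamily_pow_pred_eq_iff (e : Fin (2 * g) ≃ ι) (hη₀ : IsRiemannForm Φ η₀)
    (hη : IsRiemannForm Φ η)
    (hs : ∀ k, s k = (torusIntegral Φ e (wedgeFamily g (mixedFamily (ofRealForm (-η₀)) (ofRealForm (-η)) g k))).re)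
    (hg : 2 ≤ g) : s (g - 1) ^ g = s 0 * s g ^ (g - 1) ↔ ∃ c : ℝ, η = c • η₀ :=
  ComplexTorus.torusIntegral_mixedFamily_pow_pred_eq_iff Φ e hη₀.1 hη.1 hη₀.2.2 hη.2.2 hs hg

/-- **Equality in Brunn–Minkowski for two polarisations** iff `c₁(L) = c · c₁(L₀)` (`g ≥ 2`).
[cite: Cutkosky2013, §6 Proposition 6.5 4) and Theorem 6.13 (arXiv PDF pp. 18, 20)] -/
theorem IsRiemannForm.rpow_add_rpow_eq_rpow_torusIntegral_wedgePow_add_iff (e : Fin (2 * g) ≃ ι)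
    (hη₀ : IsRiemannForm Φ η₀) (hη : IsRiemannForm Φ η)
    (hs : ∀ k, s k = (torusIntegral Φ e (wedgeFamily g (mixedFamily (ofRealForm (-η₀)) (ofRealForm (-η)) g k))).re)
    (hg : 2 ≤ g) :
    s g ^ (1 / g : ℝ) + s 0 ^ (1 / g : ℝ) = (torusIntegral Φ e (wedgePow (ofRealForm (-(η₀ + η))) g)).re ^ (1 / g : ℝ) ↔
      ∃ c : ℝ, η = c • η₀ :=
  ComplexTorus.rpow_add_rpow_eq_rpow_torusIntegral_wedgePow_add_iff Φ e hη₀.1 hη.1 hη₀.2.2 hη.2.2 hs hg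

end Polarised

end Torus

end ComplexTorus

end Literature.Geometry.Kaehler

end
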